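import Literature.NumberTheory.EllipticCurves.CanonicalPAdicHeightCycGaloisProofs
import Literature.NumberTheory.EllipticCurves.PadicSigmaSqThetaNormedAlgebraProofs
import Literature.NumberTheory.EllipticCurves.CanonicalPAdicHeightCycSigmaNormLogProofs
import Literature.NumberTheory.NumberFields.PrimesAbovePEmbeddingNormProofs
import HarnessLib

/-!
# Existence of THE canonical cyclotomic `2`-adic height datum over a number field `H`, from a
# sigma-squared pair of `W ⊗ ℚ₂` (proofs only)

Topic `Literature/NumberTheory/EllipticCurves` (trunk T-NT-EC); PROOFS file (theorems only). The
assembly (A5) of the programme proving the named fact `WeierstrassCurve.exists_isCanonicalCyc`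
(`CanonicalPAdicHeightCyc.lean`) in the case `p = 2`, ANY number field `H` (no splitting assumption:
`2` may ramify), for `W/ℚ` elliptic with integer coefficients, GIVEN a sigma-squared pair of `W ⊗ ℚ₂`
(`IsMazurTateSigmaSqPair`; for the cm7 quadratic twists of the cell `bsd-print-cf2` this is the tree
theorem `cm7Twist_exists_isMazurTateSigmaSqPair_two`). Mazur–Stein–Tate 2006 §2.6–2.8 run on
`Σ = σ²` with the `p`-part read at the `[H:ℚ]` embeddings `H → ℂ₂`:

1. the torsion-free `Aut(H/ℚ)`-stable subgroup `G ≤ E(H)` containing the admissible locus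
   (`exists_addSubgroup_cycLocus_two_galois`);
2. **the parallelogram law of the height formula** `ĥ = log₂ N𝔡(x) − Σ_{w∣2} log₂ N Σ₂(z)` on generic
   pairs of `G` (`canonicalPAdicHeightCyc_parallelogram_two`): Néron's denominator law over `H`
   (`absNorm_denominatorIdeal_parallelogram`) + the squared theta relation at the `σ`-images
   (`padicAlgEval_padicSigmaSq_theta_ringHom`) summed over `σ : H → ℂ₂` against the Iwasawa logarithm
   of `ℂ₂` (`algebraMap_sigmaSqNormLog_eq_sum_embeddings`, `log_algebraMap_padic`), the extra terms
   `2 log₂ N(x₁ − x₂)` cancelling;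
3. Jordan–von Neumann (`parallelogram_of_generic`, `exists_pairing_of_parallelogram`) and the AVERAGE
   over the finite group `Aut(H/ℚ)` (invariance), canonical on admissible points by
   `canonicalPAdicHeightCyc_pointGalHom`.

Result: `exists_isCanonicalCyc_two_of_pair` — `∃ DH : PAdicHeightDataK W 2 H, DH.IsCanonicalCyc ∧`
(`Aut(H/ℚ)`-invariance), the conclusion of `exists_isCanonicalCyc` at `p = 2` without its
`IsGloballyMinimal`/ordinarity binders (they only make the predicate meaningful). BSD is not proved
by any of this.

## References

* B. Mazur, W. Stein, J. Tate, Doc. Math. Extra Vol. Coates (2006), §1, §2.6–2.8. [MazurSteinTate2006]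
* D. Disegni, Compos. Math. 153 (2017), §1.3.1, §4.1.1 (4.1.7)–(4.1.8). [Disegni2017]
* J. H. Silverman, Math. Ann. 332 (2005), §5 Rem. 2 (`σ²` at `p = 2`). [Silverman2005DivPoly]
-/

noncomputable section

open scoped Classical
open IsDedekindDomain NumberField WeierstrassCurve
open Literature.NumberTheory.NumberFields Literature.NumberTheory.Transcendental
  Literature.NumberTheory.LocalFields

namespace Literature.NumberTheory.EllipticCurves

variable (W : WeierstrassCurve ℚ) [W.IsElliptic] [W.IsIntegral ℤ] (H : Type) [Field H] [NumberField H]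

omit [W.IsElliptic] [W.IsIntegral ℤ] in
/-- `(W ⊗ ℚ₂) ⊗ ℂ₂ = W ⊗ ℂ₂`. [folklore] -/
private theorem baseChange_two_baseChange :
    (W.baseChange ℚ_[2]).baseChange ℂ_[2] = W.baseChange ℂ_[2] := by
  rw [baseChange, baseChange, baseChange, map_map]
  congr 1
  exact Subsingleton.elim _ _

variable {W H} in
omit [W.IsElliptic] in
/-- **Embedding-side facts for a point of the `2`-adic disc locus**: if `(x, y) ∈ E(H)` has
`1 < w(4x)` at every prime `w ∋ 2`, then for every `σ : H → ℂ₂`: `‖σ x‖ > 1`, `σ y ≠ 0`,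
`z = −x/y ≠ 0`, `σ z = −σx/σy` and `‖σ z‖ < 1` (bridge `one_lt_norm_embedding_of_forall_one_lt_valuation`
+ `param_facts_alg`). [cite: MazurSteinTate2006, §2.7] -/
theorem emb_facts_of_disc {x y : H} (h : (W.baseChange H).toAffine.Nonsingular x y)
    (hd : ∀ w : HeightOneSpectrum (𝓞 H), ((2 : ℕ) : 𝓞 H) ∈ w.asIdeal → 1 < w.valuation H (4 * x))
    (σ : H →ₐ[ℚ] ℂ_[2]) :
    1 < ‖σ x‖ ∧ -x / y ≠ 0 ∧ σ (-x / y) = -σ x / σ y ∧ ‖σ (-x / y)‖ < 1 ∧ σ (-x / y) ≠ 0 := by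
  have h4 : 1 < ‖σ (4 * x)‖ :=
    one_lt_norm_embedding_of_forall_one_lt_valuation (p := 2) (σ : H →+* ℂ_[2]) hd
  have hx : 1 < ‖σ x‖ := by
    rw [map_mul, norm_mul] at h4
    have h4n : ‖σ (4 : H)‖ ≤ 1 := by
      rw [map_ofNat, show (4 : ℂ_[2]) = algebraMap ℚ_[2] ℂ_[2] 4 by rw [map_ofNat], norm_algebraMap']
      exact_mod_cast Padic.norm_int_le_one (p := 2) 4
    exact lt_of_lt_of_le h4 (mul_le_of_le_one_left (norm_nonneg _) h4n)
  have hh : (W.baseChange ℂ_[2]).toAffine.Nonsingular (σ x) (σ y) :=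
    (Affine.baseChange_nonsingular (W := W.toAffine) (f := σ) σ.toRingHom.injective x y).mpr h
  have heq : ((W.baseChange ℚ_[2]).baseChange ℂ_[2]).toAffine.Equation (σ x) (σ y) :=
    ((baseChange_two_baseChange W).symm ▸ hh).1
  obtain ⟨hy0, hz0, hz1, -, -⟩ := (W.baseChange ℚ_[2]).param_facts_alg heq hx
  have hσz : σ (-x / y) = -σ x / σ y := by rw [map_div₀, map_neg]
  have hx0 : x ≠ 0 := fun h0 => by rw [h0, map_zero, norm_zero] at hx; exact not_lt.mpr zero_le_one hx
  have hy : y ≠ 0 := fun h0 => by rw [h0, map_zero] at hy0; exact hy0 rfl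
  refine ⟨hx, div_ne_zero (neg_ne_zero.mpr hx0) hy, hσz, by rwa [hσz], by rwa [hσz]⟩

variable {W H} in
/-- **The height formula satisfies the parallelogram law on generic pairs of the `2`-adic locus**
(`p = 2`, any number field `H`, sigma-squared pair of `W ⊗ ℚ₂` given): for affine `P = (x₁, y₁)`,
`Q = (x₂, y₂) ∈ E(H)` with `P ± Q = (x₃, y₃), (x₄, y₄)` all four having `1 < w(4x)` at every `w ∋ 2`,
and `P, Q` with non-singular reduction everywhere:
`ĥ(P+Q) + ĥ(P−Q) = 2ĥ(P) + 2ĥ(Q)` for `ĥ = canonicalPAdicHeightCyc W 2 H`. Denominators: Néron's laws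
summed over the places of `H` (`N𝔡₃N𝔡₄ = N𝔡₁²N𝔡₂²N(x₁−x₂)²`); `2`-part: after `ι : ℚ₂ → ℂ₂`,
`ι(S zᵢ) = Σ_σ Log Σ₂(σzᵢ)` and the squared theta relation `Σ₂(σz₃)Σ₂(σz₄) = (σx₂−σx₁)²Σ₂(σz₁)²Σ₂(σz₂)²`
at every embedding, so that the terms `2 log₂ N(x₁−x₂)` cancel. [cite: MazurSteinTate2006, §2.8]
[cite: MazurTate1991, Thm. 3.1] -/
theorem canonicalPAdicHeightCyc_parallelogram_two
    (hpair : ∃ Sq : PowerSeries ℚ_[2], ∃ c : ℚ_[2], (W.baseChange ℚ_[2]).IsMazurTateSigmaSqPair Sq c)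
    {x₁ y₁ x₂ y₂ x₃ y₃ x₄ y₄ : H}
    (h₁ : (W.baseChange H).toAffine.Nonsingular x₁ y₁) (h₂ : (W.baseChange H).toAffine.Nonsingular x₂ y₂)
    (h₃ : (W.baseChange H).toAffine.Nonsingular x₃ y₃) (h₄ : (W.baseChange H).toAffine.Nonsingular x₄ y₄)
    (hS : (.some x₁ y₁ h₁ : (W.baseChange H).toAffine.Point) + .some x₂ y₂ h₂ = .some x₃ y₃ h₃)
    (hD : (.some x₁ y₁ h₁ : (W.baseChange H).toAffine.Point) - .some x₂ y₂ h₂ = .some x₄ y₄ h₄)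
    (hx : x₁ ≠ x₂)
    (hd₁ : ∀ w : HeightOneSpectrum (𝓞 H), ((2 : ℕ) : 𝓞 H) ∈ w.asIdeal → 1 < w.valuation H (4 * x₁))
    (hd₂ : ∀ w : HeightOneSpectrum (𝓞 H), ((2 : ℕ) : 𝓞 H) ∈ w.asIdeal → 1 < w.valuation H (4 * x₂))
    (hd₃ : ∀ w : HeightOneSpectrum (𝓞 H), ((2 : ℕ) : 𝓞 H) ∈ w.asIdeal → 1 < w.valuation H (4 * x₃))
    (hd₄ : ∀ w : HeightOneSpectrum (𝓞 H), ((2 : ℕ) : 𝓞 H) ∈ w.asIdeal → 1 < w.valuation H (4 * x₄))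
    (hns₁ : ∀ v : HeightOneSpectrum (𝓞 H), W.HasNonsingularReductionAtK H v x₁ y₁)
    (hns₂ : ∀ v : HeightOneSpectrum (𝓞 H), W.HasNonsingularReductionAtK H v x₂ y₂) :
    W.canonicalPAdicHeightCyc 2 H (.some x₃ y₃ h₃) + W.canonicalPAdicHeightCyc 2 H (.some x₄ y₄ h₄) =
      2 * W.canonicalPAdicHeightCyc 2 H (.some x₁ y₁ h₁) +
        2 * W.canonicalPAdicHeightCyc 2 H (.some x₂ y₂ h₂) := by
  have hmul2 : padicLog_mul 2 := padicLog_mul_holds 2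
  -- the denominator identity and its logarithm (verbatim as over `K`)
  have hden := absNorm_denominatorIdeal_parallelogram h₁ h₂ h₃ h₄ hx hS hD fun v => ⟨hns₁ v, hns₂ v⟩
  have hN0 : ∀ x : H, ((Ideal.absNorm (WeierstrassCurve.denominatorIdeal H x) : ℚ) : ℚ_[2]) ≠ 0 :=
    fun x => by
    exact_mod_cast Ideal.absNorm_eq_zero_iff.not.mpr (denominatorIdeal_ne_bot H x)
  have hδ : ((Algebra.norm ℚ (x₁ - x₂) : ℚ) : ℚ_[2]) ≠ 0 := by
    exact_mod_cast Algebra.norm_ne_zero_iff.mpr (sub_ne_zero.mpr hx)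
  have hdenp : ((Ideal.absNorm (WeierstrassCurve.denominatorIdeal H x₃) : ℚ) : ℚ_[2]) *
      ((Ideal.absNorm (WeierstrassCurve.denominatorIdeal H x₄) : ℚ) : ℚ_[2]) =
        ((Ideal.absNorm (WeierstrassCurve.denominatorIdeal H x₁) : ℚ) : ℚ_[2]) ^ 2 *
          ((Ideal.absNorm (WeierstrassCurve.denominatorIdeal H x₂) : ℚ) : ℚ_[2]) ^ 2 *
          ((Algebra.norm ℚ (x₁ - x₂) : ℚ) : ℚ_[2]) ^ 2 := by
    have := congrArg (fun q : ℚ => (q : ℚ_[2])) hden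
    push_cast at this ⊢
    exact this
  have hlogd : padicLog 2 ((Ideal.absNorm (WeierstrassCurve.denominatorIdeal H x₃) : ℚ) : ℚ_[2]) +
      padicLog 2 ((Ideal.absNorm (WeierstrassCurve.denominatorIdeal H x₄) : ℚ) : ℚ_[2]) =
        2 * padicLog 2 ((Ideal.absNorm (WeierstrassCurve.denominatorIdeal H x₁) : ℚ) : ℚ_[2]) +
          2 * padicLog 2 ((Ideal.absNorm (WeierstrassCurve.denominatorIdeal H x₂) : ℚ) : ℚ_[2]) +
          2 * padicLog 2 ((Algebra.norm ℚ (x₁ - x₂) : ℚ) : ℚ_[2]) := by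
    rw [← hmul2 (hN0 x₃) (hN0 x₄), hdenp,
      hmul2 (mul_ne_zero (pow_ne_zero 2 (hN0 x₁)) (pow_ne_zero 2 (hN0 x₂))) (pow_ne_zero 2 hδ),
      hmul2 (pow_ne_zero 2 (hN0 x₁)) (pow_ne_zero 2 (hN0 x₂)), padicLog_sq (hN0 x₁),
      padicLog_sq (hN0 x₂), padicLog_sq hδ]
  -- the `2`-part, read in `ℂ₂`
  obtain ⟨Log, -, hmul, hlog, hLp⟩ := PadicComplex.exists_iwasawaLog (p := 2)
  set ι := algebraMap ℚ_[2] ℂ_[2] with hι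
  set S := W.sigmaSqNormLog 2 H with hSdef
  set T : ℂ_[2] → ℂ_[2] := fun t => Log (padicAlgEval ℂ_[2] (W.baseChange ℚ_[2]).padicSigmaSq t)
    with hT
  -- embedding-side facts for the four points
  have hf₁ := fun σ => emb_facts_of_disc (W := W) h₁ hd₁ σ
  have hf₂ := fun σ => emb_facts_of_disc (W := W) h₂ hd₂ σ
  have hf₃ := fun σ => emb_facts_of_disc (W := W) h₃ hd₃ σ
  have hf₄ := fun σ => emb_facts_of_disc (W := W) h₄ hd₄ σ
  -- `ι(S zᵢ) = Σ_σ T(σ zᵢ)`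
  haveI : Nonempty (H →ₐ[ℚ] ℂ_[2]) := by
    have : 0 < Fintype.card (H →ₐ[ℚ] ℂ_[2]) := by
      rw [AlgHom.card ℚ H ℂ_[2]]; exact Module.finrank_pos
    exact Fintype.card_pos_iff.mp this
  obtain ⟨σ₀⟩ := (inferInstance : Nonempty (H →ₐ[ℚ] ℂ_[2]))
  have hι₁ : ι (S (-x₁ / y₁)) = ∑ σ : H →ₐ[ℚ] ℂ_[2], T (σ (-x₁ / y₁)) :=
    algebraMap_sigmaSqNormLog_eq_sum_embeddings hmul hlog hLp (hf₁ σ₀).2.1 fun σ => (hf₁ σ).2.2.2.1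
  have hι₂ : ι (S (-x₂ / y₂)) = ∑ σ : H →ₐ[ℚ] ℂ_[2], T (σ (-x₂ / y₂)) :=
    algebraMap_sigmaSqNormLog_eq_sum_embeddings hmul hlog hLp (hf₂ σ₀).2.1 fun σ => (hf₂ σ).2.2.2.1
  have hι₃ : ι (S (-x₃ / y₃)) = ∑ σ : H →ₐ[ℚ] ℂ_[2], T (σ (-x₃ / y₃)) :=
    algebraMap_sigmaSqNormLog_eq_sum_embeddings hmul hlog hLp (hf₃ σ₀).2.1 fun σ => (hf₃ σ).2.2.2.1
  have hι₄ : ι (S (-x₄ / y₄)) = ∑ σ : H →ₐ[ℚ] ℂ_[2], T (σ (-x₄ / y₄)) :=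
    algebraMap_sigmaSqNormLog_eq_sum_embeddings hmul hlog hLp (hf₄ σ₀).2.1 fun σ => (hf₄ σ).2.2.2.1
  -- the squared theta relation at every embedding, logarithmic form
  have hθ : ∀ σ : H →ₐ[ℚ] ℂ_[2],
      T (σ (-x₃ / y₃)) + T (σ (-x₄ / y₄)) =
        2 * Log (σ (x₁ - x₂)) + 2 * T (σ (-x₁ / y₁)) + 2 * T (σ (-x₂ / y₂)) := by
    intro σ
    obtain ⟨hx₁n, -, hz₁, -, hz₁0⟩ := hf₁ σ
    obtain ⟨hx₂n, -, hz₂, -, hz₂0⟩ := hf₂ σ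
    obtain ⟨-, -, hz₃, -, -⟩ := hf₃ σ
    obtain ⟨-, -, hz₄, -, -⟩ := hf₄ σ
    have key := W.padicAlgEval_padicSigmaSq_theta_ringHom 2 hpair H (σ : H →+* ℂ_[2]) h₁ h₂ h₃ h₄ hS hD
      hx₁n hx₂n hx
    have hS₁ := W.padicAlgEval_padicSigmaSq_ringHom_ne_zero 2 H (σ : H →+* ℂ_[2]) h₁ hx₁n
    have hS₂ := W.padicAlgEval_padicSigmaSq_ringHom_ne_zero 2 H (σ : H →+* ℂ_[2]) h₂ hx₂n
    have hS₃ := W.padicAlgEval_padicSigmaSq_ringHom_ne_zero 2 H (σ : H →+* ℂ_[2]) h₃ (hf₃ σ).1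
    have hS₄ := W.padicAlgEval_padicSigmaSq_ringHom_ne_zero 2 H (σ : H →+* ℂ_[2]) h₄ (hf₄ σ).1
    have hδ' : (σ : H →+* ℂ_[2]) x₂ - (σ : H →+* ℂ_[2]) x₁ ≠ 0 :=
      sub_ne_zero.mpr fun h => hx ((σ : H →+* ℂ_[2]).injective h).symm
    have hsq : ((σ : H →+* ℂ_[2]) x₂ - (σ : H →+* ℂ_[2]) x₁) ^ 2 = (σ (x₁ - x₂)) ^ 2 := by
      rw [map_sub]; change (σ x₂ - σ x₁) ^ 2 = (σ x₁ - σ x₂) ^ 2; ring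
    have hδ0 : σ (x₁ - x₂) ≠ 0 := (map_ne_zero σ).mpr (sub_ne_zero.mpr hx)
    simp only [hT, hz₁, hz₂, hz₃, hz₄]
    change Log (padicAlgEval ℂ_[2] (W.baseChange ℚ_[2]).padicSigmaSq (-(σ : H →+* ℂ_[2]) x₃ / (σ : H →+* ℂ_[2]) y₃)) +
        Log (padicAlgEval ℂ_[2] (W.baseChange ℚ_[2]).padicSigmaSq (-(σ : H →+* ℂ_[2]) x₄ / (σ : H →+* ℂ_[2]) y₄)) =
      2 * Log (σ (x₁ - x₂)) +
        2 * Log (padicAlgEval ℂ_[2] (W.baseChange ℚ_[2]).padicSigmaSq (-(σ : H →+* ℂ_[2]) x₁ / (σ : H →+* ℂ_[2]) y₁)) +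
        2 * Log (padicAlgEval ℂ_[2] (W.baseChange ℚ_[2]).padicSigmaSq (-(σ : H →+* ℂ_[2]) x₂ / (σ : H →+* ℂ_[2]) y₂))
    rw [← hmul _ _ hS₃ hS₄, key, hsq, hmul _ _ (mul_ne_zero (pow_ne_zero 2 hδ0) (pow_ne_zero 2 hS₁))
      (pow_ne_zero 2 hS₂), hmul _ _ (pow_ne_zero 2 hδ0) (pow_ne_zero 2 hS₁), logFun_pow hmul hδ0,
      logFun_pow hmul hS₁, logFun_pow hmul hS₂]
    push_cast
    ring
  -- `Σ_σ Log σ(x₁ − x₂) = ι log₂ N(x₁ − x₂)`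
  have hδsum : ∑ σ : H →ₐ[ℚ] ℂ_[2], Log (σ (x₁ - x₂)) =
      ι (padicLog 2 ((Algebra.norm ℚ (x₁ - x₂) : ℚ) : ℚ_[2])) := by
    have hne : Algebra.norm ℚ (x₁ - x₂) ≠ 0 := Algebra.norm_ne_zero_iff.mpr (sub_ne_zero.mpr hx)
    rw [← logFun_prod hmul _ fun σ _ => (map_ne_zero σ).mpr (sub_ne_zero.mpr hx),
      ← Algebra.norm_eq_prod_embeddings ℚ ℂ_[2] (x₁ - x₂),
      show algebraMap ℚ ℂ_[2] (Algebra.norm ℚ (x₁ - x₂)) = ι ((Algebra.norm ℚ (x₁ - x₂) : ℚ) : ℚ_[2]) by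
        rw [eq_ratCast, hι, map_ratCast],
      log_algebraMap_padic hmul hlog hLp (by exact_mod_cast hne)]
  -- the `2`-part identity in `ℚ₂` (by injectivity of `ι`)
  have hsig : S (-x₃ / y₃) + S (-x₄ / y₄) =
      2 * S (-x₁ / y₁) + 2 * S (-x₂ / y₂) + 2 * padicLog 2 ((Algebra.norm ℚ (x₁ - x₂) : ℚ) : ℚ_[2]) := by
    apply (algebraMap ℚ_[2] ℂ_[2]).injective
    rw [map_add, ← hι, hι₃, hι₄, ← Finset.sum_add_distrib, Finset.sum_congr rfl fun σ _ => hθ σ,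
      Finset.sum_add_distrib, Finset.sum_add_distrib, ← Finset.mul_sum, ← Finset.mul_sum, ← Finset.mul_sum,
      hδsum, ← hι₁, ← hι₂]
    simp only [map_add, map_mul, map_ofNat]
    ring
  -- conclusion
  simp only [WeierstrassCurve.canonicalPAdicHeightCyc_some]
  rw [← hSdef] at *
  linear_combination hlogd - hsig

/-- **Existence of THE canonical cyclotomic `2`-adic height datum over a number field `H`**, for
`W/ℚ` elliptic with integer coefficients, from a sigma-squared pair of `W ⊗ ℚ₂` (no assumption on the
splitting of `2` in `H`): there is a symmetric bilinear torsion-vanishing pairing on `E(H)`, invariant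
under `Aut(H/ℚ)`, whose quadratic form on every `2`-adically admissible point is
`[H:ℚ]⁻¹ · (log₂ N𝔡_H(x) − Σ_{w∣2} log₂ N_{H_w/ℚ₂} Σ₂(z))` (`IsCanonicalCyc`). This is the conclusion
of the named fact `exists_isCanonicalCyc` at `p = 2` (MST 2006 §2.6–2.8 on `Σ = σ²`, the `2`-part read
at the embeddings `H → ℂ₂`; the datum is obtained on the torsion-free `Aut`-stable subgroup of the
admissible locus by Jordan–von Neumann and averaged over `Aut(H/ℚ)`).
[cite: MazurSteinTate2006, §2.8] [cite: Disegni2017, §1.3.1 (arXiv v3 PDF p. 7 L30–38)]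
[cite: Silverman2005DivPoly, §5 Rem. 2] -/
theorem exists_isCanonicalCyc_two_of_pair
    (hpair : ∃ Sq : PowerSeries ℚ_[2], ∃ c : ℚ_[2], (W.baseChange ℚ_[2]).IsMazurTateSigmaSqPair Sq c) :
    ∃ DH : PAdicHeightDataK W 2 H, DH.IsCanonicalCyc ∧
      ∀ (σ : H ≃ₐ[ℚ] H) (a b : (W.baseChange H).toAffine.Point),
        DH.pairing (pointGalHom W H σ a) (pointGalHom W H σ b) = DH.pairing a b := by
  -- (1) the subgroup
  obtain ⟨G, htf, hmem, hloc, -, hstab⟩ := exists_addSubgroup_cycLocus_two_galois W H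
  -- (2) the scaled height formula and its parallelogram law on `G`
  set c : ℚ_[2] := ((Module.finrank ℚ H : ℕ) : ℚ_[2])⁻¹ with hc
  set q : (W.baseChange H).toAffine.Point → ℚ_[2] := fun P => c * W.canonicalPAdicHeightCyc 2 H P
    with hq
  have hq0 : q 0 = 0 := by simp only [hq, WeierstrassCurve.canonicalPAdicHeightCyc_zero, mul_zero]
  have hgen : ∀ P ∈ G, ∀ Q ∈ G, P ≠ 0 → Q ≠ 0 → P - Q ≠ 0 → P + Q ≠ 0 →
      q (P + Q) + q (P - Q) = 2 * q P + 2 * q Q := by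
    intro P hP Q hQ hP0 hQ0 hsub hadd
    rcases P with _ | ⟨x₁, y₁, h₁⟩
    · exact (hP0 rfl).elim
    rcases Q with _ | ⟨x₂, y₂, h₂⟩
    · exact (hQ0 rfl).elim
    have hx : x₁ ≠ x₂ := X_ne_of_sub_ne_zero_of_add_ne_zero h₁ h₂ hsub hadd
    have hPQ := G.add_mem hP hQ
    have hPQ' := G.sub_mem hP hQ
    rcases hS : (.some x₁ y₁ h₁ : (W.baseChange H).toAffine.Point) + .some x₂ y₂ h₂ with _ | ⟨x₃, y₃, h₃⟩
    · exact (hadd hS).elim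
    rcases hD : (.some x₁ y₁ h₁ : (W.baseChange H).toAffine.Point) - .some x₂ y₂ h₂ with _ | ⟨x₄, y₄, h₄⟩
    · exact (hsub hD).elim
    rw [hS] at hPQ
    rw [hD] at hPQ'
    obtain ⟨hd₁, hns₁⟩ := (hmem h₁).mp hP
    obtain ⟨hd₂, hns₂⟩ := (hmem h₂).mp hQ
    obtain ⟨hd₃, -⟩ := (hmem h₃).mp hPQ
    obtain ⟨hd₄, -⟩ := (hmem h₄).mp hPQ'
    have key := canonicalPAdicHeightCyc_parallelogram_two hpair h₁ h₂ h₃ h₄ hS hD hx hd₁ hd₂ hd₃ hd₄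
      hns₁ hns₂
    rw [hS, hD]
    simp only [hq]
    linear_combination c * key
  have hfull := parallelogram_of_generic G htf q hq0 hgen
  obtain ⟨B, hsymm, htors, hdiag⟩ := exists_pairing_of_parallelogram G q hfull
  -- (3) the average over `Aut(H/ℚ)`
  set Γ := (H ≃ₐ[ℚ] H)
  set e : ℚ_[2] := ((Fintype.card Γ : ℕ) : ℚ_[2])⁻¹ with he
  have hcard : ((Fintype.card Γ : ℕ) : ℚ_[2]) ≠ 0 := by exact_mod_cast Fintype.card_ne_zero
  let avg₀ : (W.baseChange H).toAffine.Point → (W.baseChange H).toAffine.Point →+ ℚ_[2] := fun a =>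
    { toFun := fun b => e * ∑ τ : Γ, B (pointGalHom W H τ a) (pointGalHom W H τ b)
      map_zero' := by simp
      map_add' := fun b b' => by
        simp only [map_add, Finset.sum_add_distrib, mul_add] }
  let avg : (W.baseChange H).toAffine.Point →+ (W.baseChange H).toAffine.Point →+ ℚ_[2] :=
    { toFun := avg₀
      map_zero' := by ext b; simp [avg₀]
      map_add' := fun a a' => by
        ext b
        simp only [avg₀, map_add, AddMonoidHom.add_apply, AddMonoidHom.coe_mk, ZeroHom.coe_mk,
          Finset.sum_add_distrib, mul_add] }
  have havg : ∀ a b, avg a b = e * ∑ τ : Γ, B (pointGalHom W H τ a) (pointGalHom W H τ b) :=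
    fun _ _ => rfl
  refine ⟨⟨avg, fun a b => ?_, fun a b ha => ?_⟩, ?_, ?_⟩
  · -- symmetry
    rw [havg, havg]
    exact congrArg _ (Finset.sum_congr rfl fun τ _ => hsymm _ _)
  · -- torsion
    rw [havg]
    have : ∀ τ : Γ, B (pointGalHom W H τ a) (pointGalHom W H τ b) = 0 := fun τ =>
      htors _ _ ((pointGalHom W H τ).isOfFinAddOrder ha)
    simp [this]
  · -- canonical on admissible points
    intro P hP
    have hPG : P ∈ G := hloc P hP.2
    change avg P P = _
    rw [havg]
    have hτ : ∀ τ : Γ, B (pointGalHom W H τ P) (pointGalHom W H τ P) =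
        c * W.canonicalPAdicHeightCyc 2 H P := fun τ => by
      rw [hdiag _ (hstab τ P hPG)]
      simp only [hq, canonicalPAdicHeightCyc_pointGalHom]
    simp only [hτ, Finset.sum_const, Finset.card_univ, nsmul_eq_mul]
    rw [he, ← mul_assoc, inv_mul_cancel₀ hcard, one_mul, hc]
  · -- invariance under `Aut(H/ℚ)`
    intro σ a b
    change avg (pointGalHom W H σ a) (pointGalHom W H σ b) = avg a b
    rw [havg, havg]
    congr 1
    refine Fintype.sum_equiv (Equiv.mulRight σ) _ _ fun τ => ?_
    simp only [Equiv.coe_mulRight, map_mul]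
    rfl

end Literature.NumberTheory.EllipticCurves

end
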